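import Summits.CriticalPhenomena.CardyFormulaZ2.Theorems.CardyIKTransportIKLinearTransportQuenchedAssemblyDefs
import Summits.CriticalPhenomena.CardyFormulaZ2.Theorems.CardyIKTransportIKLinearTransportRatioMixStub
import Summits.CriticalPhenomena.CardyFormulaZ2.Theorems.CardyIKTransportIKLinearTransportScreeningGlue

/-!
# Fragment `approxHarris_separated` (line `pinned-diagram-exchange`, crux `CardyIKTransport.IKLinearTransport`,
# stmt-CriticalPhenomena-5076): the SEPARATED two-event case of the shared core `ApproxHarrisFam`

Support file (`--supports stmt-CriticalPhenomena-5076`, registered stub `approxHarris_separated`).  The shared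
quenched core `QuenchedChainFKG.ApproxHarrisFam` asks, for every number `k` of box-crossing events and every
`η > 0`, for a scale beyond which `μ(⋂) ≥ ∏ μ − η` uniformly in the column pattern `S`.  This file proves its
two-event case WHEN THE SECOND BOX LIES AT SUP-DISTANCE `≥ n` FROM THE FIRST (every cell of the second box is in
`farFrom bs₁.a bs₁.b bs₁.w bs₁.h n`), for first boxes of aspect `≤ k` at scale `n`, from the LANDED density-form
ratio mixing `stub_RatioMix` (no FKG input):

* the crossing event `L` of the first box is determined by the cells and faces of that box
  (`lrCross_mem_determinedOn` / `tbCross_mem_determinedOn`), the crossing event `E` of the second box is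
  determined by the second box, hence by the far region containing it (monotonicity of `determinedOn`, inlined);
* ratio mixing at `(k, η)` gives `|ν_S(E ∩ L) − ν_S(E) ν_S(L)| ≤ η ν_S(E) ν_S(L) ≤ η` beyond its scale `N`
  (probabilities are at most `1`), so `ν_S(E ∩ L) ≥ ν_S(E) ν_S(L) − η`;
* transfer to the gauge space: `boxEvent S bs = obs S ⁻¹' (crossing event)`, `νmix S = μIK.map (obs S)` and the
  crossing events are measurable.

Theorems only (no new vocabulary).
-/

noncomputable section

namespace Summit.CriticalPhenomena.CardyFormulaZ2.Theorems.IKLinearTransport.PinnedDiagramExchange.QuenchedAssembly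

open scoped Classical
open MeasureTheory Set
open Summit.CriticalPhenomena.CardyFormulaZ2.Theorems.IKLinearTransport.PinnedDiagramExchange
open Summit.CriticalPhenomena.CardyFormulaZ2.Cruxes.IKMixedBoxCrossing.QuenchedChainFKG
  (ApproxHarrisFam BoxSpec boxEvent boxProb)
open Summit.CriticalPhenomena.CardyFormulaZ2.Cruxes.IKMixedBoxCrossing.PairedMirrorExploration.DualityStub
  (measurableSet_lrCross measurableSet_tbCross)
open Literature.Probability.Percolation Literature.Probability.LatticeModels

namespace ApproxHarrisSeparated

/-! ## §1 The crossing event of a box specification, on the observable side -/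

/-- The crossing event (of observables) of the box specification `bs`, by `if` on its kind, is measurable. [folklore] -/
theorem measurableSet_cross (bs : BoxSpec) :
    MeasurableSet (if bs.lr then lrCross bs.a bs.b bs.w bs.h else tbCross bs.a bs.b bs.w bs.h) := by
  split
  · exact measurableSet_lrCross _ _ _ _
  · exact measurableSet_tbCross _ _ _ _

/-- The crossing event of the box specification `bs` is determined by the cells and faces of its box. [folklore] -/
theorem cross_mem_determinedOn (bs : BoxSpec) :
    (if bs.lr then lrCross bs.a bs.b bs.w bs.h else tbCross bs.a bs.b bs.w bs.h) ∈
      determinedOn {v : Site 2 | bs.a ≤ v 0 ∧ v 0 < bs.a + bs.w ∧ bs.b ≤ v 1 ∧ v 1 < bs.b + bs.h} := by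
  split
  · exact lrCross_mem_determinedOn _ _ _ _
  · exact tbCross_mem_determinedOn _ _ _ _

/-- The annealed probability of a box specification is the `ν_S`-probability of its crossing event. [folklore] -/
theorem boxProb_eq_nuMix (S : Set ℤ) (bs : BoxSpec) :
    boxProb S bs = (νmix S).real (if bs.lr then lrCross bs.a bs.b bs.w bs.h else tbCross bs.a bs.b bs.w bs.h) := by
  rw [nuMix_real_eq S (measurableSet_cross bs)]
  rfl

/-- The probability of the intersection of two box events is the `ν_S`-probability of the intersection of the
two crossing events (in the opposite order). [folklore] -/
theorem inter_eq_nuMix (S : Set ℤ) (bs₁ bs₂ : BoxSpec) :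
    μIK.real (boxEvent S bs₁ ∩ boxEvent S bs₂) =
      (νmix S).real ((if bs₂.lr then lrCross bs₂.a bs₂.b bs₂.w bs₂.h else tbCross bs₂.a bs₂.b bs₂.w bs₂.h) ∩
        (if bs₁.lr then lrCross bs₁.a bs₁.b bs₁.w bs₁.h else tbCross bs₁.a bs₁.b bs₁.w bs₁.h)) := by
  rw [nuMix_real_eq S ((measurableSet_cross bs₂).inter (measurableSet_cross bs₁)), Set.preimage_inter,
    Set.inter_comm]
  rfl

/-- The elementary endgame: `|x − e l| ≤ η e l` with `0 ≤ e, l ≤ 1` and `0 ≤ η` gives `e l − η ≤ x`. [folklore] -/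
theorem endgame {x e l η : ℝ} (hx : |x - e * l| ≤ η * (e * l)) (he0 : 0 ≤ e) (he1 : e ≤ 1) (hl0 : 0 ≤ l)
    (hl1 : l ≤ 1) (hη : 0 ≤ η) : e * l - η ≤ x := by
  have h1 : e * l - η * (e * l) ≤ x := by
    have := (abs_le.1 hx).1
    linarith
  have h2 : e * l ≤ 1 := mul_le_one₀ he1 hl0 hl1
  have h3 : 0 ≤ e * l := mul_nonneg he0 hl0
  nlinarith

end ApproxHarrisSeparated

open ApproxHarrisSeparated in
/-- **THE SEPARATED TWO-EVENT CASE OF APPROXIMATE HARRIS** (registered stub `approxHarris_separated`): for every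
aspect bound `k` and `η > 0` there is a scale `n₀` such that for every pattern `S`, every `n ≥ n₀`, every first
box of size `n ≤ w ≤ k n`, `n ≤ h ≤ k n` and every second box all of whose cells lie at sup-distance `≥ n` from the
first, `μ(A₁ ∩ A₂) ≥ μ(A₁) μ(A₂) − η` for the two box-crossing events.  From the landed density-form ratio mixing
`stub_RatioMix` (`E` := the crossing event of the second box, determined by the far region; `L` := that of the
first box, determined by the box) and `ν_S(E) ν_S(L) ≤ 1`. [folklore] -/
theorem approxHarris_separated : ∀ (k : ℕ) (η : ℝ), 0 < η → ∃ n₀ : ℕ, ∀ (S : Set ℤ) (n : ℕ), n₀ ≤ n → ∀ bs₁ bs₂ : BoxSpec, n ≤ bs₁.w → bs₁.w ≤ k * n → n ≤ bs₁.h → bs₁.h ≤ k * n → (∀ v : Site 2, bs₂.a ≤ v 0 → v 0 < bs₂.a + bs₂.w → bs₂.b ≤ v 1 → v 1 < bs₂.b + bs₂.h → v ∈ farFrom bs₁.a bs₁.b bs₁.w bs₁.h n) → boxProb S bs₁ * boxProb S bs₂ - η ≤ μIK.real (boxEvent S bs₁ ∩ boxEvent S bs₂) := by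
  intro k η hη
  obtain ⟨N, hN⟩ := stub_RatioMix k η hη
  refine ⟨N, fun S n hn bs₁ bs₂ _ hw _ hh hfar => ?_⟩
  haveI := isProbabilityMeasure_nuMix S
  -- the far event `E` (second box) and the box event `L` (first box), on the observable side
  set E : Set Obs := if bs₂.lr then lrCross bs₂.a bs₂.b bs₂.w bs₂.h else tbCross bs₂.a bs₂.b bs₂.w bs₂.h
    with hE
  set L : Set Obs := if bs₁.lr then lrCross bs₁.a bs₁.b bs₁.w bs₁.h else tbCross bs₁.a bs₁.b bs₁.w bs₁.h
    with hL
  have hEdet : E ∈ determinedOn (farFrom bs₁.a bs₁.b bs₁.w bs₁.h n) := fun x y hxy =>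
    cross_mem_determinedOn bs₂ x y fun v hv => hxy v (hfar v hv.1 hv.2.1 hv.2.2.1 hv.2.2.2)
  have hLdet : L ∈ determinedOn
      {v : Site 2 | bs₁.a ≤ v 0 ∧ v 0 < bs₁.a + bs₁.w ∧ bs₁.b ≤ v 1 ∧ v 1 < bs₁.b + bs₁.h} :=
    cross_mem_determinedOn bs₁
  have hmix := hN S n hn bs₁.a bs₁.b bs₁.w bs₁.h hw hh E L (measurableSet_cross bs₂) (measurableSet_cross bs₁)
    hEdet hLdet
  rw [boxProb_eq_nuMix S bs₁, boxProb_eq_nuMix S bs₂, inter_eq_nuMix S bs₁ bs₂, ← hE, ← hL, mul_comm]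
  exact endgame hmix measureReal_nonneg measureReal_le_one measureReal_nonneg measureReal_le_one hη.le

end Summit.CriticalPhenomena.CardyFormulaZ2.Theorems.IKLinearTransport.PinnedDiagramExchange.QuenchedAssembly

end
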